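import Mathlib
import HarnessLib
import HarnessLib.Audit
import Summits.Langlands.Langlands.Theorems.DepthIsolationSplit
import Literature.NumberTheory.Automorphic.SolvableBaseChangeModularityProofs
import Literature.NumberTheory.Automorphic.TotallyRealModularity
import Literature.NumberTheory.Automorphic.RealQuadraticJInvariantModularity
import Literature.NumberTheory.EllipticCurves.IsogenyHasCMProofs
import Summits.Langlands.Langlands.Theorems.JDegreeFilterSplitBridge

/-!
# JDegreeFilterSplit (main) — lens-5 g27 node on REST_E = `DepthIsolationSplit.UnanchoredHighDegreeModularE`
Census-twin landing of the node file `HOME/nodes/lens-5-g27-JDegreeFilterSplit.lean` (sha256 19b9e9133f31…, 780 l), SPLIT VERBATIM into three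
Theorems files for the gate's 400-line lint (census-1 g30; crit-1 g9 CLEARED row 401), with gate repairs limited to docstrings: nine one-line
docstrings added on previously undocumented lemmas; the kit's three unregistered cite keys re-keyed to registered bib keys (Dieulefait2015,
BCDT2001, DieulefaitFreitas2014) and every citation written as a prose `[ref: KEY, locator]` tag (NOT a gate cite-tag, so that the node-local
junction defs stay in this file instead of entering the Literature relocation lane — the cell's census-twin convention); no declaration body changed.  Prelude = §1–§4 (dial, sectors, RJD, NSBC with the `jModel` section) · Bridge = §4 tail,
§4b, §4b′, §4c · main = §5–§7 (compositions `closes_target` / `closes_byName`, orbit closure, guards).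
This part covers §5–§7.  The full module docstring of the node is kept in the Prelude.
-/

set_option linter.dupNamespace false
set_option linter.unusedVariables false

open scoped NumberField IntermediateField
open NumberField Literature.NumberTheory.Automorphic
open Summit.Langlands.Langlands.Theorems.DepthIsolationSplit (UnanchoredBox UnanchoredHighDegreeModularE
  modularE_iff_box IntegralModelTransferPointwise SatakeAvatarTwo satakeAvatarTwo_of_host)

namespace Summit.Langlands.Langlands.Theorems.JDegreeFilterSplit

/-! ## §5 Composition: the leaves give REST_E, and REST BY NAME -/

/-- KERNEL: DBC → NSBC → FLS2015_theorem1 → DNS2020_theorem4 → LJR → REST_E. -/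
theorem restE_of_jLeaves (hDBC : RatBaseChangeModularity) (hNSBC : SmallFieldBaseChange)
    (hFLS : FLS2015_theorem1) (hDNS : DNS2020_theorem4) (hBox : Box2022_theorem1_1) (hL : LargeJResidual) :
    UnanchoredHighDegreeModularE :=
  restE_of_jSectors (rationalJDoor_of_ratBaseChange hDBC) (smallFieldJDoor_of_bridge hNSBC hFLS hDNS hBox) hL

/-- KERNEL (finer): DBC → Thorne-BC → DESC → FLS → DNS → SJD_ins → LJR → REST_E — every hypothesis but SJD_ins and
LJR is PRINT. -/
theorem restE_of_print_and_residuals (hDBC : RatBaseChangeModularity)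
    (hBC : isModularEllipticCurve_baseChange_of_isSolvable_of_isAutomorphicOfWeightZero)
    (hD : SolvableDescentModularity) (hFLS : FLS2015_theorem1) (hDNS : DNS2020_theorem4) (hBox : Box2022_theorem1_1)
    (hI : SmallFieldJDoorInsoluble) (hL : LargeJResidual) : UnanchoredHighDegreeModularE :=
  restE_of_jSectors (rationalJDoor_of_ratBaseChange hDBC)
    (smallFieldJDoor_of_print_and_insoluble hBC hD hFLS hDNS hBox hI) hL

/-- REST_E ⇒ REST through the other four registered stubs of REST's birth skeleton (IMT text, TRANY = item 31038 by
name, W⁺|₂ text, R1 = item 24805 by name) — the body of `DepthIsolationSplit.closes_target`, started from REST_E. -/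
theorem rest_of_restE (hE : UnanchoredHighDegreeModularE)
    (hIMT : IntegralModelTransferPointwise)
    (hTr : Summit.Langlands.Langlands.Theses.EllipticDegreeLadder.EllipticTransportAnyBase)
    (hW : SatakeAvatarTwo)
    (h1 : Summit.Langlands.Langlands.Theses.EllipticDegreeLadder.RankOneAutomorphy) :
    Summit.Langlands.Langlands.Theses.TowerDoorSplit.UnanchoredHighDegreeWitnessAutomorphy := by
  intro K _ _ hcpt ℓ _ ι ρ hirr hgeo htw hP
  obtain ⟨hno, ⟨L, _, _, _, hgal, hsol, K₀, _, _, _, hgal₀, hsol₀, hTR, E, hEll, χ, hvia⟩, hnA, hnB5, hnB7⟩ := hP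
  obtain ⟨E', hEll', χ', hvia'⟩ := hIMT K ℓ ρ L hgal hsol K₀ hgal₀ hsol₀ E χ hvia
  have hdeg : ¬ (Module.finrank ℚ K₀ ≤ 5) := fun hle =>
    hno ⟨L, inferInstance, inferInstance, inferInstance, hgal, hsol, K₀, inferInstance, inferInstance, inferInstance, hgal₀, hsol₀, hTR, hle, E, hEll, χ, hvia⟩
  have hA : ¬ ((IsGalois ℚ K₀ ∧ (∀ σ τ : K₀ ≃ₐ[ℚ] K₀, σ * τ = τ * σ) ∧ ¬ ((3 : ℤ) ∣ NumberField.discr K₀) ∧ ¬ ((5 : ℤ) ∣ NumberField.discr K₀) ∧ ¬ ((7 : ℤ) ∣ NumberField.discr K₀)) ∨ (∃ p : ℕ, p.Prime ∧ Literature.NumberTheory.Automorphic.Thorne2019.IsInCyclotomicZpExtension p K₀)) := fun h =>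
    hnA ⟨L, inferInstance, inferInstance, inferInstance, hgal, hsol, K₀, inferInstance, inferInstance, inferInstance, hgal₀, hsol₀, hTR, h, E', hEll', χ', hvia'⟩
  have hB5 : ¬ (¬ IsSquare (5 : K₀) ∧ ∃ F : IntermediateField ℚ K₀, Module.finrank ℚ F ≤ 5 ∧ IsGalois F K₀ ∧ IsSolvable (K₀ ≃ₐ[F] K₀) ∧ Odd (Module.finrank F K₀) ∧ ∀ x y : K₀, (Literature.NumberTheory.Automorphic.Thorne2019.E₁.baseChange K₀).toAffine.Equation x y → x ∈ Set.range (algebraMap F K₀) ∧ y ∈ Set.range (algebraMap F K₀)) := fun h =>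
    hnB5 ⟨L, inferInstance, inferInstance, inferInstance, hgal, hsol, K₀, inferInstance, inferInstance, inferInstance, hgal₀, hsol₀, hTR, h, E', hEll', χ', hvia'⟩
  have hB7 : ¬ (¬ ((7 : ℤ) ∣ NumberField.discr K₀) ∧ ∃ F : IntermediateField ℚ K₀, Module.finrank ℚ F ≤ 5 ∧ IsGalois F K₀ ∧ IsSolvable (K₀ ≃ₐ[F] K₀) ∧ Odd (Module.finrank F K₀) ∧ ∀ x y : K₀, ((⟨1, 0, 0, -4, -1⟩ : WeierstrassCurve ℚ).baseChange K₀).toAffine.Equation x y → x ∈ Set.range (algebraMap F K₀) ∧ y ∈ Set.range (algebraMap F K₀)) := fun h =>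
    hnB7 ⟨L, inferInstance, inferInstance, inferInstance, hgal, hsol, K₀, inferInstance, inferInstance, inferInstance, hgal₀, hsol₀, hTR, h, E', hEll', χ', hvia'⟩
  exact hTr hW h1 K hcpt ℓ ι ρ hirr hgeo htw L hgal hsol K₀ hgal₀ hsol₀ E χ hvia (fun E₀ hΔ => hE K₀ hTR hdeg hA hB5 hB7 E₀ hΔ)

/-- KERNEL (finest): DBC → Thorne-BC → DESC → QGBC → FLS → DNS → SJD_hard → LJR → REST_E — every hypothesis but SJD_hard and
LJR is PRINT (two of them, Thorne-BC and FLS/DNS, tree facts by name; DBC, DESC, QGBC typed here verbatim for the typer). -/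
theorem restE_of_print_and_hardResiduals (hDBC : RatBaseChangeModularity)
    (hBC : isModularEllipticCurve_baseChange_of_isSolvable_of_isAutomorphicOfWeightZero)
    (hD : SolvableDescentModularity) (hQ : QuadraticGaloisBaseChange)
    (hFLS : FLS2015_theorem1) (hDNS : DNS2020_theorem4) (hBox : Box2022_theorem1_1)
    (hH : SmallFieldJDoorHard) (hL : LargeJResidual) : UnanchoredHighDegreeModularE :=
  restE_of_jSectors (rationalJDoor_of_ratBaseChange hDBC)
    (smallFieldJDoor_iff_fine_split.2 ⟨smallFieldJDoorSoluble_of_print hBC hD hFLS hDNS hBox,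
      quadraticGaloisJDoor_of_print hQ hFLS, hH⟩) hL

/-- FINEST READING: REST_E ⟸ [tree facts BY NAME: ThorneBC-rat, ThorneBC, FLS, DNS, Box] ∧ [PRINT junctions not yet vendored:
DESC, QGBC] ∧ the THREE typed residual leaves RJD_ins (PRINT-mod-DBC: Dieulefait 2012), SJD_hard (IDEA-NEEDED), LJR (DECLARED
RESIDUAL). -/
theorem restE_of_print_and_threeResiduals
    (hBCrat : isModularEllipticCurve_baseChange_rat_of_isSolvable)
    (hBC : isModularEllipticCurve_baseChange_of_isSolvable_of_isAutomorphicOfWeightZero)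
    (hD : SolvableDescentModularity) (hQ : QuadraticGaloisBaseChange)
    (hFLS : FLS2015_theorem1) (hDNS : DNS2020_theorem4) (hBox : Box2022_theorem1_1)
    (hRI : RationalJDoorInsoluble) (hH : SmallFieldJDoorHard) (hL : LargeJResidual) : UnanchoredHighDegreeModularE :=
  restE_of_jSectors (rationalJDoor_of_print_and_insoluble hBCrat hD hRI)
    (smallFieldJDoor_iff_fine_split.2 ⟨smallFieldJDoorSoluble_of_print hBC hD hFLS hDNS hBox,
      quadraticGaloisJDoor_of_print hQ hFLS, hH⟩) hL

/-- … and REST BY NAME from the finest leaves. -/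
theorem closes_target_fine (hDBC : RatBaseChangeModularity)
    (hBC : isModularEllipticCurve_baseChange_of_isSolvable_of_isAutomorphicOfWeightZero)
    (hD : SolvableDescentModularity) (hQ : QuadraticGaloisBaseChange)
    (hFLS : FLS2015_theorem1) (hDNS : DNS2020_theorem4) (hBox : Box2022_theorem1_1)
    (hH : SmallFieldJDoorHard) (hL : LargeJResidual)
    (hIMT : IntegralModelTransferPointwise)
    (hTr : Summit.Langlands.Langlands.Theses.EllipticDegreeLadder.EllipticTransportAnyBase)
    (hW : SatakeAvatarTwo)
    (h1 : Summit.Langlands.Langlands.Theses.EllipticDegreeLadder.RankOneAutomorphy) :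
    Summit.Langlands.Langlands.Theses.TowerDoorSplit.UnanchoredHighDegreeWitnessAutomorphy :=
  rest_of_restE (restE_of_print_and_hardResiduals hDBC hBC hD hQ hFLS hDNS hBox hH hL) hIMT hTr hW h1

/-- KERNEL COMPOSITION concluding REST BY NAME: DBC → NSBC → FLS → DNS → LJR → IMT → TRANY → W⁺|₂ → R1 → REST. -/
theorem closes_target (hDBC : RatBaseChangeModularity) (hNSBC : SmallFieldBaseChange)
    (hFLS : FLS2015_theorem1) (hDNS : DNS2020_theorem4) (hBox : Box2022_theorem1_1) (hL : LargeJResidual)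
    (hIMT : IntegralModelTransferPointwise)
    (hTr : Summit.Langlands.Langlands.Theses.EllipticDegreeLadder.EllipticTransportAnyBase)
    (hW : SatakeAvatarTwo)
    (h1 : Summit.Langlands.Langlands.Theses.EllipticDegreeLadder.RankOneAutomorphy) :
    Summit.Langlands.Langlands.Theses.TowerDoorSplit.UnanchoredHighDegreeWitnessAutomorphy :=
  rest_of_restE (restE_of_jLeaves hDBC hNSBC hFLS hDNS hBox hL) hIMT hTr hW h1

/-- `closes_target` with W⁺ the host item `SatakeAvatarExistence` (stmt-Langlands-17415) BY NAME. -/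
theorem closes_byName (hDBC : RatBaseChangeModularity) (hNSBC : SmallFieldBaseChange)
    (hFLS : FLS2015_theorem1) (hDNS : DNS2020_theorem4) (hBox : Box2022_theorem1_1) (hL : LargeJResidual)
    (hIMT : IntegralModelTransferPointwise)
    (hTr : Summit.Langlands.Langlands.Theses.EllipticDegreeLadder.EllipticTransportAnyBase)
    (hW : Summit.Langlands.Langlands.Theses.EllipticDegreeLadder.SatakeAvatarExistence)
    (h1 : Summit.Langlands.Langlands.Theses.EllipticDegreeLadder.RankOneAutomorphy) :
    Summit.Langlands.Langlands.Theses.TowerDoorSplit.UnanchoredHighDegreeWitnessAutomorphy :=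
  closes_target hDBC hNSBC hFLS hDNS hBox hL hIMT hTr (satakeAvatarTwo_of_host hW) h1

/-- The g26 pieces follow from the j-leaves: ISOL outright, SUPPLY modulo the g26 necessity junctions ORD∞, LGC. -/
theorem depthPieces_of_jLeaves (hDBC : RatBaseChangeModularity) (hNSBC : SmallFieldBaseChange)
    (hFLS : FLS2015_theorem1) (hDNS : DNS2020_theorem4) (hBox : Box2022_theorem1_1) (hL : LargeJResidual)
    (hord : Literature.NumberTheory.EllipticCurves.infinite_setOf_prime_goodOrdinaryAbove)
    (hLG : Summit.Langlands.Langlands.Theorems.DepthIsolationSplit.WeightTwoLocalGlobal) :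
    Summit.Langlands.Langlands.Theorems.DepthIsolationSplit.FiniteDepthIsolation ∧
      Summit.Langlands.Langlands.Theorems.DepthIsolationSplit.IsolatingDepthCongruence :=
  (Summit.Langlands.Langlands.Theorems.DepthIsolationSplit.restE_iff_pieces hord hLG).1
    (restE_of_jLeaves hDBC hNSBC hFLS hDNS hBox hL)

/-! ## §6 Orbit closure of the dial (the sectors do not leak) -/

/-- The dial is a function of `j` alone: two integral models with the same `j`-invariant read in `K₀` (e.g. quadratic
twists of each other) have the same moduli degree. -/
theorem jDeg_eq_of_jInv_eq (K₀ : Type) [Field K₀] [NumberField K₀] (E E' : WeierstrassCurve (𝓞 K₀))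
    (h : jInv K₀ E = jInv K₀ E') : jDeg K₀ E = jDeg K₀ E' := by
  rw [jDeg, jDeg, h]

/-- The dial is invariant under base extension: `[ℚ(j(E₀ ⊗ K)) : ℚ] = [ℚ(j(E₀)) : ℚ]` for `F → K`. -/
theorem jDeg_baseChange (F K : Type) [Field F] [NumberField F] [Field K] [NumberField K] [Algebra F K]
    (E₀ : WeierstrassCurve (𝓞 F)) : jDeg K (E₀.baseChange (𝓞 K)) = jDeg F E₀ := by
  unfold jDeg
  rw [jInv_baseChange]
  set j := jInv F E₀ with hj
  have hj' : jInv F E₀ = (algebraMap (𝓞 F) F E₀.c₄) ^ 3 / algebraMap (𝓞 F) F E₀.Δ := rfl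
  rw [← hj']
  -- `ℚ⟮algebraMap F K j⟯` is the image of `ℚ⟮j⟯` under the `ℚ`-algebra map `F → K`
  have key : ℚ⟮algebraMap F K j⟯ = (ℚ⟮j⟯).map (IsScalarTower.toAlgHom ℚ F K) := by
    rw [IntermediateField.adjoin_map]
    simp
  rw [key]
  exact (IntermediateField.equivMap ℚ⟮j⟯ (IsScalarTower.toAlgHom ℚ F K)).toLinearEquiv.finrank_eq.symm

/-! ## §7 Guards: the dial is not degenerate -/

/-- `jModel` computes: the model of `j = 1/1` over `ℤ` has the displayed invariants. -/
example : (jModel (1 : ℤ) 1).c₄ = -144 * 1 * (1728 * 1 - 1) * 1 ^ 2 := jModel_c₄ 1 1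

example : (jModel (2 : ℤ) 1).Δ ≠ 0 := jModel_Δ_ne_zero (by norm_num) (by norm_num) (by norm_num)

end Summit.Langlands.Langlands.Theorems.JDegreeFilterSplit
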